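import Summits.Ventures.Crystal3D.Theorems.StickyWulffConstantTextureLiminfTexShadowWeakZigSplit
import Summits.Ventures.Crystal3D.Theorems.StickyWulffConstantTextureLiminfTexShadowBothFccDefs
import Summits.Ventures.Crystal3D.Theorems.StickyWulffConstantTextureLiminfTexShadowDeficitMinDefs
import HarnessLib

/-!
# TexShadow v6.19 vocabulary — the THREE NAMED DEBTS behind `stub_famCoaxial`: lane F's UNIFORM co-axial matrix (F-U, as lane T reads it),
# the (β-iii) carve-out (six `Σ9` cells + separated-wide, L-2′-dependent) and the FAULTED remainder (T-F2)
# (lane T, crux `TextureLiminf`, stmt-Ventures-19483; line `TexShadow`; cf-p1 DECISIONS (xlv⁗) R1, (li) «F-U text of record := hFU», v6.19 plan)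

HONEST FRAMING. Venture `Summits/Ventures/Crystal3D` (cell `crystal3d-full`), helper `--supports` the crux `TextureLiminf`
(stmt-Ventures-19483) of `route-Ventures-StickyWulffConstant`, registered line `TexShadow`.  DEFINITIONS ONLY (plus `From` forms);
nothing is proved or claimed about them; rung credit only; F-C1 not moved.  cf-p1 (li): «stub_famCoaxial becomes a THEOREM from
{stub_coaxialTwoSlabAdhesionUnif [F-U by name], stub_betaIII [L-2′/(β-iii)], stub_famFaulted [T-F2]} … HβIII and HFaulted: you choose both
texts».  The assembly `famCoaxial_of_dispatch` is the next file (`…TexShadowFamCoaxialAssembly`).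

* **`CoaxialUnifAt C R₀`** — lane F's co-axial fcc|fcc cell AT ONE THICKNESS with ONE constant, uniform in the pair: VERBATIM the matrix of
  `CoaxialTwoSlabAdhesion` (…CoaxialWallLawWallLedgerFDefs) with `∃ C R₀, 1 ≤ R₀ ∧` deleted and the cell pulled inside the shared-frame `∃`
  (= the hypothesis `hFU` of `bilayerWallAt_of_bothFcc`, p676725; = the text of record (li) for lane F's `CoaxialTwoSlabAdhesionUnifFrom R :=
  ∀ R₀, R ≤ R₀ → ∃ C, CoaxialUnifAt C R₀`, which 19481-p2 types on the F side — this file only NAMES the matrix so T's assembly has a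
  short hypothesis; whichever of the two names lands first, the other unfolds to it);
* **`BilayerWallBetaIII C R₀`** (+ `From`) — the (β-iii) CARVE-OUT: a `BothFcc` presented pair with bilayer frames, `hgen`, an admissible table,
  whose `(0,0)` bilayer frames are NOT co-axial and lie in one of lane G's six `Σ9` cells or the separated-wide cell, satisfies the cell
  inequality.  Owner: lane G's uniform priced-class accounting for those seven cells (G-CL / L-2′, cf-p1 DECISION (l)); T consumes it by
  name.  Why it might fail: exactly lane G's residual-cap question (c_G on the terrace caps vs the law's charge);
* **`BilayerWallFaultedOnReachCoaxial C R₀`**, **`BilayerWallFaultedZigCoaxial C R₀`** (+ `From`) — T-F2: the corner-keyed (`…OnReachCoaxial`,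
  p671420) and zig-keyed (`…ZigCoaxial`, p672103) co-axial coincidence classes RESTRICTED to `¬BothFcc σ₁ σ₂` (some plate carries a fault
  in its presented word: hcp/dhcp/twin lamella/single fault against anything registered to it).  Owner open (cf-p1 (xlv′): per-bilayer
  co-axial law «F_layer» vs (L3)); hypothesis lists verbatim those of the unrestricted classes plus `¬BothFcc`.
* **`HStripPayerPool C R₀`** (+ `From`) — the Deficit-MIN stub of record in PAYER-POOL currency (cf-p1 DECISION (lii)(1): «(c2) per-cell payer
  pool, consumed by `bilayerWallAt_of_payerBound` exactly as (β) was»): on the Deficit-MIN class (`BilayerWallDeficitMin`'s hypotheses verbatim: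
  generic pair, admissible table, neither zig-flux- nor row-mix-dominated in any of the four presentations) the WHOLE table charge of the cell
  is dominated by the payer sum, `2·Σ' c_ij·|slice ∩ slab₁ i ∩ slab₂ j| ≤ Σ_{PAY}(12 − deg) + C(1+h)ρ`, `PAY = {y ∈ X : deg y ≠ 12,
  −R₀−2 ≤ y₂ ≤ h+R₀+2}` (literally the `hpay` of `bilayerWallAt_of_payerBound`).  ONE count per cell: the certificate (owner cf-p2 g20,
  (L3) prism-slot / second-centre on {Barlow words with an h-layer in the window} × {RowSteep ∧ ¬ZigGood}) must deliver rows on `++` strips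
  AND the new h-strip payers from the same payer set without double counting — hence the whole-table form rather than an «excess» form.
So `famCoaxial` = {BothFcc: zero cell ∪ F-U ∪ payer pools ∪ BetaIII} ∪ {¬BothFcc: Faulted·}, the BothFcc half is a theorem modulo F-U/BetaIII,
and `stub_bilayerWallDeficit` = `HStripPayerPoolFrom` by `bilayerWallDeficitMinFrom_of_pool` (next file).
WHAT THIS IS NOT: no proof of any of the four debts; not lane F's definition file; F-C1 not moved.
-/

noncomputable section

open scoped BigOperators InnerProductSpace ENNReal
open MeasureTheory Filter

namespace Summit.Ventures.Crystal3D.Cruxes.TextureLiminf.TexShadow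

open Summit.Ventures.Crystal3D Summit.Ventures.Crystal3D.Theorems
open Literature.MathematicalPhysics.StatisticalMechanics (IsHaggSeq fccStacking barlowStacking contactDeficiency basalMirror)

/-! ## F-U as lane T reads it: the uniform co-axial matrix at one thickness -/

/-- **Lane F's co-axial fcc|fcc cell at thickness `R₀` with constant `C`, UNIFORM in the pair** (the matrix of `CoaxialTwoSlabAdhesion`
with its per-pair `∃ C R₀` removed): for every CO-AXIAL pair of DISTINCT affine fcc lattices `(P₁· + t₁) '' Λ₀`, `(P₂· + t₂) '' Λ₀` there
are shared-frame data `(L, r₁, r₂, σ, σ')` such that in every clamped cylinder cell the adhesion excess of the filling is at most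
`(φ₁ + φ₂ − ½√(1−⟪Le₃,e₃⟫²))πρ² + C(1+h)ρ`.  (Text of record for `CoaxialTwoSlabAdhesionUnifFrom R := ∀ R₀ ≥ R, ∃ C, CoaxialUnifAt C R₀`,
cf-p1 (li).) -/
def CoaxialUnifAt (C R₀ : ℝ) : Prop :=
  ∀ (P₁ : E3 ≃ₗᵢ[ℝ] E3) (t₁ : E3) (P₂ : E3 ≃ₗᵢ[ℝ] E3) (t₂ : E3),
    (∃ (L : E3 ≃ₗᵢ[ℝ] E3) (r₁ r₂ : E3) (σ σ' : ℤ → ℤ), IsHaggSeq σ ∧ IsHaggSeq σ' ∧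
        (fun p => P₁ p + t₁) '' fccStacking 1 (Real.sqrt (2 / 3)) ⊆
          (fun p => L p + r₁) '' barlowStacking 1 (Real.sqrt (2 / 3)) σ ∧
        (fun p => P₂ p + t₂) '' fccStacking 1 (Real.sqrt (2 / 3)) ⊆
          (fun p => L p + r₂) '' barlowStacking 1 (Real.sqrt (2 / 3)) σ') →
    (fun p => P₁ p + t₁) '' fccStacking 1 (Real.sqrt (2 / 3)) ≠
      (fun p => P₂ p + t₂) '' fccStacking 1 (Real.sqrt (2 / 3)) →
    ∃ (L : E3 ≃ₗᵢ[ℝ] E3) (r₁ r₂ : E3) (σ σ' : ℤ → ℤ), IsHaggSeq σ ∧ IsHaggSeq σ' ∧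
      (fun p => P₁ p + t₁) '' fccStacking 1 (Real.sqrt (2 / 3)) ⊆
        (fun p => L p + r₁) '' barlowStacking 1 (Real.sqrt (2 / 3)) σ ∧
      (fun p => P₂ p + t₂) '' fccStacking 1 (Real.sqrt (2 / 3)) ⊆
        (fun p => L p + r₂) '' barlowStacking 1 (Real.sqrt (2 / 3)) σ' ∧
      ∀ h : ℝ, 0 ≤ h → ∀ ρ : ℝ, R₀ ≤ ρ → ∀ X Q₁ Q₂ : Finset E3,
        (∀ p ∈ X, ∀ q ∈ X, p ≠ q → 1 ≤ dist p q) → Q₁ ⊆ X → Q₂ ⊆ X \ Q₁ →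
        (∀ p ∈ X, -(2 * R₀) ≤ p 2 ∧ p 2 ≤ h + 2 * R₀ ∧ p 0 ^ 2 + p 1 ^ 2 ≤ ρ ^ 2) →
        (∀ p, p ∈ Q₁ ↔ (p ∈ (fun q => P₁ q + t₁) '' fccStacking 1 (Real.sqrt (2 / 3)) ∧
          -(2 * R₀) ≤ p 2 ∧ p 2 ≤ -R₀ ∧ p 0 ^ 2 + p 1 ^ 2 ≤ ρ ^ 2)) →
        (∀ p, p ∈ Q₂ ↔ (p ∈ (fun q => P₂ q + t₂) '' fccStacking 1 (Real.sqrt (2 / 3)) ∧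
          h + R₀ ≤ p 2 ∧ p 2 ≤ h + 2 * R₀ ∧ p 0 ^ 2 + p 1 ^ 2 ≤ ρ ^ 2)) →
        ((((Q₁ ×ˢ (X \ Q₁)).filter fun pq => dist pq.1 pq.2 = 1).card : ℕ) : ℝ) +
          ((((Q₂ ×ˢ ((X \ Q₁) \ Q₂)).filter fun pq => dist pq.1 pq.2 = 1).card : ℕ) : ℝ) ≤
          contactDeficiency ((X \ Q₁) \ Q₂) +
            (Real.sqrt 2 / 4 * ∑ᶠ w ∈ {w ∈ fccStacking 1 (Real.sqrt (2 / 3)) | ‖w‖ = 1},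
                |⟪w, P₁.symm (EuclideanSpace.single (2 : Fin 3) (1 : ℝ))⟫_ℝ| +
              Real.sqrt 2 / 4 * ∑ᶠ w ∈ {w ∈ fccStacking 1 (Real.sqrt (2 / 3)) | ‖w‖ = 1},
                |⟪w, P₂.symm (EuclideanSpace.single (2 : Fin 3) (1 : ℝ))⟫_ℝ| -
              (1 / 2 : ℝ) * Real.sqrt (1 - ⟪L (EuclideanSpace.single (2 : Fin 3) (1 : ℝ)),
                (EuclideanSpace.single (2 : Fin 3) (1 : ℝ))⟫_ℝ ^ 2)) * Real.pi * ρ ^ 2 +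
            C * (1 + h) * ρ

/-- F-U in lane T's `From` shape: the uniform co-axial matrix from thickness `R` on (`∀ R₀ ≥ R, ∃ C`). -/
def CoaxialUnifFrom (R : ℝ) : Prop := ∀ R₀ : ℝ, R ≤ R₀ → ∃ C : ℝ, CoaxialUnifAt C R₀

/-! ## The (β-iii) carve-out and the faulted remainder -/

/-- **The (β-iii) carve-out** (L-2′-dependent debt, owner lane G / G-CL): a `BothFcc` presented pair with bilayer frames, `hgen`, an admissible
table, whose `(0,0)` bilayer frames are NOT co-axial and fall in one of the six `Σ9` cells or the separated-wide cell, satisfies the cell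
inequality at `(C, R₀)`. -/
def BilayerWallBetaIII (C R₀ : ℝ) : Prop :=
  ∀ (σ₁ σ₂ : ℤ → ℤ), IsHaggSeq σ₁ → IsHaggSeq σ₂ → BothFcc σ₁ σ₂ →
    ∀ (L₁ L₂ : E3 ≃ₗᵢ[ℝ] E3) (s₁ s₂ : E3) (A₁ A₂ : ℤ → (E3 ≃ₗᵢ[ℝ] E3)) (u₁ u₂ : ℤ → E3),
    BilayerFramesAt L₁ s₁ σ₁ A₁ u₁ → BilayerFramesAt L₂ s₂ σ₂ A₂ u₂ →
    (∀ i j : ℤ, ¬ InResidualClass (A₁ i) (A₂ j) (u₁ i) (u₂ j)) →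
    ∀ (c : ℤ → ℤ → ℝ) (m : ℤ → ℤ → E3), BilayerChargeAdmissible A₁ A₂ c m →
      ¬ CoAx (A₁ 0) (A₂ 0) →
      (Sigma9OneSidedAt (A₁ 0) (A₂ 0) ∨ Sigma9OneSidedDownAt (A₁ 0) (A₂ 0) ∨ Sigma9TiltAt (A₁ 0) (A₂ 0) ∨
        Sigma9TiltDownAt (A₁ 0) (A₂ 0) ∨ Sigma9WideAt (A₁ 0) (A₂ 0) ∨ Sigma9WideDownAt (A₁ 0) (A₂ 0) ∨
        SeparatedWideAt (A₁ 0) (A₂ 0)) →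
      BilayerWallAt C R₀ σ₁ σ₂ L₁ L₂ s₁ s₂ c

/-- The (β-iii) carve-out from thickness `R` on. -/
def BilayerWallBetaIIIFrom (R : ℝ) : Prop := ∀ R₀ : ℝ, R ≤ R₀ → ∃ C : ℝ, BilayerWallBetaIII C R₀

/-- **T-F2, corner-keyed half**: the co-axial coincidence class of record (`BilayerWallOnReachCoaxial`'s hypotheses verbatim) RESTRICTED to
FAULTED pairs (`¬BothFcc`: some plate's presented word is not sign-constant). -/
def BilayerWallFaultedOnReachCoaxial (C R₀ : ℝ) : Prop :=
  ∀ (σ₁ σ₂ : ℤ → ℤ), IsHaggSeq σ₁ → IsHaggSeq σ₂ → ¬ BothFcc σ₁ σ₂ →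
    ∀ (L₁ L₂ : E3 ≃ₗᵢ[ℝ] E3) (s₁ s₂ : E3) (A₁ A₂ : ℤ → (E3 ≃ₗᵢ[ℝ] E3)) (u₁ u₂ : ℤ → E3),
    BilayerFramesAt L₁ s₁ σ₁ A₁ u₁ → BilayerFramesAt L₂ s₂ σ₂ A₂ u₂ →
    (∀ i j : ℤ, ¬ InResidualClass (A₁ i) (A₂ j) (u₁ i) (u₂ j)) →
    ∀ (c : ℤ → ℤ → ℝ) (m : ℤ → ℤ → E3), BilayerChargeAdmissible A₁ A₂ c m → DomBy L₁ σ₁ L₂ σ₂ c →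
      (∃ F₁ ∈ cornerFrames L₁ σ₁ e₃, ∃ F₂ ∈ cornerFrames L₂ σ₂ (-e₃), CoAxFrames F₁ F₂) →
      BilayerWallAt C R₀ σ₁ σ₂ L₁ L₂ s₁ s₂ c

/-- **T-F2, zig-keyed half**: the zig-keyed co-axial class (`BilayerWallZigCoaxial`'s hypotheses verbatim) RESTRICTED to FAULTED pairs. -/
def BilayerWallFaultedZigCoaxial (C R₀ : ℝ) : Prop :=
  ∀ (σ₁ σ₂ : ℤ → ℤ), IsHaggSeq σ₁ → IsHaggSeq σ₂ → ¬ BothFcc σ₁ σ₂ →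
    ∀ (L₁ L₂ : E3 ≃ₗᵢ[ℝ] E3) (s₁ s₂ : E3) (A₁ A₂ : ℤ → (E3 ≃ₗᵢ[ℝ] E3)) (u₁ u₂ : ℤ → E3),
    BilayerFramesAt L₁ s₁ σ₁ A₁ u₁ → BilayerFramesAt L₂ s₂ σ₂ A₂ u₂ →
    (∀ i j : ℤ, ¬ InResidualClass (A₁ i) (A₂ j) (u₁ i) (u₂ j)) →
    ∀ (c : ℤ → ℤ → ℝ) (m : ℤ → ℤ → E3), BilayerChargeAdmissible A₁ A₂ c m →
      DeltaSteep L₁ e₃ → DeltaSteep L₂ (-e₃) → FluxDominated (Real.sqrt 2 / 2) L₁ σ₁ L₂ σ₂ c →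
      ¬ BarlowOffReach L₁ s₁ σ₁ L₂ s₂ σ₂ → ¬ RowMixDominated (Real.sqrt 2 / 2) L₁ σ₁ L₂ σ₂ c →
      ¬ (ZigGood L₁ σ₁ e₃ ∧ ZigGood L₂ σ₂ (-e₃)) →
      (∃ F₁ ∈ zigFrames L₁ e₃, ∃ F₂ ∈ zigFrames L₂ (-e₃), CoAxFrames F₁ F₂) →
      BilayerWallAt C R₀ σ₁ σ₂ L₁ L₂ s₁ s₂ c

/-- T-F2, corner-keyed half, from thickness `R` on. -/
def BilayerWallFaultedOnReachCoaxialFrom (R : ℝ) : Prop :=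
  ∀ R₀ : ℝ, R ≤ R₀ → ∃ C : ℝ, BilayerWallFaultedOnReachCoaxial C R₀

/-- T-F2, zig-keyed half, from thickness `R` on. -/
def BilayerWallFaultedZigCoaxialFrom (R : ℝ) : Prop :=
  ∀ R₀ : ℝ, R ≤ R₀ → ∃ C : ℝ, BilayerWallFaultedZigCoaxial C R₀

/-! ## The Deficit-MIN stub in payer-pool currency -/

open scoped Classical in
/-- **Deficit-MIN as a PAYER POOL** (T's deficit stub of record, cf-p1 (lii)): on the Deficit-MIN class — hypotheses VERBATIM those of
`BilayerWallDeficitMin` — the whole table charge of every clamped cell of thickness `R₀` is dominated by the payer sum: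
`2·Σ' c_ij·|slice ∩ slab₁ i ∩ slab₂ j| ≤ Σ_{PAY}(12 − deg) + C(1+h)ρ` (literally the `hpay` of `bilayerWallAt_of_payerBound`). -/
def HStripPayerPool (C R₀ : ℝ) : Prop :=
  ∀ (σ₁ σ₂ : ℤ → ℤ), IsHaggSeq σ₁ → IsHaggSeq σ₂ →
    ∀ (L₁ L₂ : E3 ≃ₗᵢ[ℝ] E3) (s₁ s₂ : E3) (A₁ A₂ : ℤ → (E3 ≃ₗᵢ[ℝ] E3)) (u₁ u₂ : ℤ → E3),
    BilayerFramesAt L₁ s₁ σ₁ A₁ u₁ → BilayerFramesAt L₂ s₂ σ₂ A₂ u₂ →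
    (∀ i j : ℤ, ¬ InResidualClass (A₁ i) (A₂ j) (u₁ i) (u₂ j)) →
    ∀ (c : ℤ → ℤ → ℝ) (m : ℤ → ℤ → E3), BilayerChargeAdmissible A₁ A₂ c m →
      ¬ (DeltaSteep L₁ e₃ ∧ DeltaSteep L₂ (-e₃) ∧ FluxDominated (Real.sqrt 2 / 2) L₁ σ₁ L₂ σ₂ c) →
      ¬ RowMixDominated (Real.sqrt 2 / 2) L₁ σ₁ L₂ σ₂ c →
      ¬ RowMixDominated (Real.sqrt 2 / 2) (basalMirror.trans L₁) (fun n => -σ₁ (-n - 1)) L₂ σ₂ (fun i j => c (-i - 1) j) →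
      ¬ RowMixDominated (Real.sqrt 2 / 2) L₁ σ₁ (basalMirror.trans L₂) (fun n => -σ₂ (-n - 1)) (fun i j => c i (-j - 1)) →
      ¬ RowMixDominated (Real.sqrt 2 / 2) (basalMirror.trans L₁) (fun n => -σ₁ (-n - 1))
          (basalMirror.trans L₂) (fun n => -σ₂ (-n - 1)) (fun i j => c (-i - 1) (-j - 1)) →
      ∀ h : ℝ, 0 ≤ h → ∀ ρ : ℝ, R₀ ≤ ρ → ∀ X P₁ P₂ : Finset E3,
        (∀ p ∈ X, ∀ q ∈ X, p ≠ q → 1 ≤ dist p q) → P₁ ⊆ X → P₂ ⊆ X \ P₁ → (∀ p ∈ X, p ∈ cyl R₀ h ρ) →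
        (∀ p, p ∈ P₁ ↔ (p ∈ stacking L₁ s₁ σ₁ ∧ -(2 * R₀) ≤ p 2 ∧ p 2 ≤ -R₀ ∧ p 0 ^ 2 + p 1 ^ 2 ≤ ρ ^ 2)) →
        (∀ p, p ∈ P₂ ↔ (p ∈ stacking L₂ s₂ σ₂ ∧ h + R₀ ≤ p 2 ∧ p 2 ≤ h + 2 * R₀ ∧ p 0 ^ 2 + p 1 ^ 2 ≤ ρ ^ 2)) →
        2 * (∑' ij : ℤ × ℤ, c ij.1 ij.2 *
            (volume ({q : E3 | 0 ≤ q 2 ∧ q 2 ≤ 1 ∧ q 0 ^ 2 + q 1 ^ 2 ≤ ρ ^ 2} ∩ laySlab L₁ s₁ ij.1 ∩ laySlab L₂ s₂ ij.2)).toReal) ≤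
          (∑ y ∈ X.filter (fun y => (X.filter fun q => dist y q = 1).card ≠ 12 ∧ -R₀ - 2 ≤ y 2 ∧ y 2 ≤ h + R₀ + 2),
            ((12 : ℝ) - ((X.filter fun q => dist y q = 1).card : ℝ))) + C * (1 + h) * ρ

/-- The Deficit-MIN payer pool from thickness `R` on. -/
def HStripPayerPoolFrom (R : ℝ) : Prop := ∀ R₀ : ℝ, R ≤ R₀ → ∃ C : ℝ, HStripPayerPool C R₀

/-- The unrestricted corner-keyed class gives its faulted restriction (the restriction only ADDS a hypothesis). -/
theorem faultedOnReachCoaxial_of_onReachCoaxial {C R₀ : ℝ} (h : BilayerWallOnReachCoaxial C R₀) :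
    BilayerWallFaultedOnReachCoaxial C R₀ :=
  fun σ₁ σ₂ hσ₁ hσ₂ _ L₁ L₂ s₁ s₂ A₁ A₂ u₁ u₂ hA₁ hA₂ hgen c m hadm hdom hcl =>
    h σ₁ σ₂ hσ₁ hσ₂ L₁ L₂ s₁ s₂ A₁ A₂ u₁ u₂ hA₁ hA₂ hgen c m hadm hdom hcl

/-- The unrestricted zig-keyed class gives its faulted restriction. -/
theorem faultedZigCoaxial_of_zigCoaxial {C R₀ : ℝ} (h : BilayerWallZigCoaxial C R₀) :
    BilayerWallFaultedZigCoaxial C R₀ :=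
  fun σ₁ σ₂ hσ₁ hσ₂ _ L₁ L₂ s₁ s₂ A₁ A₂ u₁ u₂ hA₁ hA₂ hgen c m hadm hΔ₁ hΔ₂ hfl hoff hrow hzg hcl =>
    h σ₁ σ₂ hσ₁ hσ₂ L₁ L₂ s₁ s₂ A₁ A₂ u₁ u₂ hA₁ hA₂ hgen c m hadm hΔ₁ hΔ₂ hfl hoff hrow hzg hcl

end Summit.Ventures.Crystal3D.Cruxes.TextureLiminf.TexShadow

end
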